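import Summits.BirchSwinnertonDyer.Rank1Residual.X12.CMTwistKodairaOdd
import HarnessLib

/-!
# CM with `3 ∤ d_K`: `3` never divides the Tamagawa product — no hypothesis at the place `3`;
# the inert-BAD-at-`3` sub-family of X12 loses its Tamagawa datum for EVERY CM field

HONEST FRAMING (cell `b2b-bsdres`, run/shared/lean/b2b/bsd-rank1-residual/, verbatim in every
file): the goal of the cell is to DELETE the COMBINATION-SHAPED residual classes of the
Birch–Swinnerton-Dyer formula for ALL analytic-rank `≤ 1` elliptic curves over `ℚ` — "full BSD
formula for every rank `≤ 1` curve in class `C`" assembled STRICTLY from published theorems — so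
that the rank-`≤ 1` remainder becomes exactly the CONSTRUCTION-SHAPED classes, which are TYPED
(missing-input `Prop`s), NOT attempted. This is not "finishing BSD". Unit `b2b-bsdres-x1b` (X12
prover owner), generation 22; research route, no claim beyond the stated class; X12 REMAINS
CONSTRUCTION-SHAPED; nothing is booked here — booking is the lane's and the referee's.

Theorems only; no definition, no new named fact.

Assembly of the three gen-22 pieces — `CMTamagawaThree.lean` (every place `v ∤ 3`: cube
discriminant, Kodaira–Néron, Ogg tame / Tate at `2`), `J1728TamagawaThree.lean` (the place `3` for
`j = 1728`: Tate's algorithm on `y² = x³ + Ax`), `CMTwistKodairaOdd.lean` (the place `3` for the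
other nine `j` with `d_K ≠ −3`: ramified quadratic twists are `I₀*`, unramified ones good):

* §1 the nine `j`-invariants `287496, −3375, 16581375, 8000, −32768, −884736, −884736000,
  −147197952000, −262537412640768000` with their base curves `32a3, 49a1, 49a2, 256a1, 121b1,
  361a1, 1849a1, 4489a1, 26569a1` (Cremona's models written inline; `j` and `3 ∤ Δ` by `norm_num`);
* §2 **`not_three_dvd_tamagawaProduct_of_hasCM_of_not_cmRamified_three`: for EVERY globally minimal
  CM curve `E/ℚ` whose CM field is not `ℚ(√−3)` (`3 ∤ d_K`), `3 ∤ ∏_ℓ c_ℓ(E)`** — no hypothesis on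
  the reduction at `3`; with gen 9's `not_dvd_tamagawaProduct_of_hasCM` (`p ≥ 5`): **every prime
  factor of `∏_ℓ c_ℓ` is `2`** (`eq_two_of_prime_dvd_tamagawaProduct_of_hasCM`);
* §3 consumers: gen 12's `p = 3` inert-BAD theorems of `InertBadOddPrime.lean` WITHOUT the
  Tamagawa datum for every CM field (`missingUpperBoundAt_three_of_classX12_of_bad'` — the upper half
  of `BSD(E,3)` modulo the Manin datum `3 ∤ c(D)` only —, `bsdp_three_of_classX12_of_bad_of_lower'`,
  `bsdp_three_of_classX12_of_bad_of_shaAn_unit'`), and the uniform odd-`p` form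
  `missingUpperBoundAt_of_classX12_of_bad_odd'` (X12, `p` odd, `p ∤ d_K`, `p ∣ N`: upper half
  modulo the Manin datum, for EVERY `p` — gen 9 at `p ≥ 5`, this file at `p = 3`).

Data (`HOME/b2b-bsdres-x1b/gen22/CM-TAM3-CENSUS.tsv`, Cremona `N < 5·10⁵`): of the 1 926 CM curves
with `d_K ≠ −3` (724 of them with `3 ∣ N`) none has `3 ∣ cp`; of the 3 966 with `d_K = −3`, 1 794 do.

References: [SilvermanATAEC1994] IV.9.4, Table 4.1, Cor. IV.9.2, IV.11.1, App. A §3;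
[SilvermanAEC2009] VII.1 Rem. 1.1, X.5.4, App. C §11; [Cremona1997] Table 1; [MatarNekovar2019]
Thm. 0.3; [Miller2011LMS] Def. 1.1; HOME `b2b-bsdres-x1b/X12-ROUTE.md` §26.
-/

noncomputable section

open scoped Classical NumberField

open WeierstrassCurve NumberField IsDedekindDomain IsDedekindDomain.HeightOneSpectrum Field
  Rat.HeightOneSpectrum Literature.NumberTheory.EllipticCurves
  Literature.NumberTheory.GaloisRepresentations
  Literature.NumberTheory.EllipticCurves.ModularForms
  Literature.NumberTheory.EllipticCurves.Rank1Residual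
  Literature.NumberTheory.EllipticCurves.Rank1Residual.Typed
  Literature.NumberTheory.Automorphic
  Literature.NumberTheory.DiophantineGeometry
  Summit.BirchSwinnertonDyer.Rank1Residual.X11b

namespace Summit.BirchSwinnertonDyer.Rank1Residual.X12

/-! ### §1 The place `3` for the nine CM `j`-invariants `∉ {0, 1728, 54000, −12288000}` -/

/-- **`j = 287496`** (`K = ℚ(i)`; base curve Cremona `32a3 = [0, 0, 0, -11, -14]`, `Δ = 512`, good at `3`): `3 ∤ c_3`.
[cite: SilvermanATAEC1994, IV.9.4 Step 6 and Table 4.1] [cite: Cremona1997, Table 1 (curve 32a3)] -/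
theorem not_three_dvd_localTamagawaNumber_three_of_j_eq_287496 (W : WeierstrassCurve ℚ) [W.IsElliptic]
    (hj : W.j = 287496) (v : HeightOneSpectrum (𝓞 ℚ)) (hv : natGenerator v = 3) :
    ¬ 3 ∣ (W.baseChange (v.adicCompletion ℚ)).localTamagawaNumber (v.adicCompletionIntegers ℚ) := by
  haveI := isElliptic_of_discOf_ne_zero 0 0 0 (-11) (-14) (by decide)
  have hjE : (⟨((0 : ℤ) : ℚ), ((0 : ℤ) : ℚ), ((0 : ℤ) : ℚ), ((-11 : ℤ) : ℚ), ((-14 : ℤ) : ℚ)⟩ : WeierstrassCurve ℚ).j = 287496 := by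
    rw [j, Units.inv_mul_eq_iff_eq_mul, coe_Δ']
    norm_num [WeierstrassCurve.c₄, WeierstrassCurve.Δ, WeierstrassCurve.b₂, WeierstrassCurve.b₄,
      WeierstrassCurve.b₆, WeierstrassCurve.b₈]
  exact not_three_dvd_localTamagawaNumber_three_of_j_eq_twist W v hv 0 0 0 (-11) (-14) (Dz := 512)
    (by norm_num [WeierstrassCurve.Δ, WeierstrassCurve.b₂, WeierstrassCurve.b₄, WeierstrassCurve.b₆,
      WeierstrassCurve.b₈]) (by decide) (hj.trans hjE.symm) (by rw [hj]; norm_num) (by rw [hj]; norm_num)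

/-- **`j = -3375`** (`K = ℚ(√−7)`; base curve Cremona `49a1 = [1, -1, 0, -2, -1]`, `Δ = -343`, good at `3`): `3 ∤ c_3`.
[cite: SilvermanATAEC1994, IV.9.4 Step 6 and Table 4.1] [cite: Cremona1997, Table 1 (curve 49a1)] -/
theorem not_three_dvd_localTamagawaNumber_three_of_j_eq_neg3375 (W : WeierstrassCurve ℚ) [W.IsElliptic]
    (hj : W.j = -3375) (v : HeightOneSpectrum (𝓞 ℚ)) (hv : natGenerator v = 3) :
    ¬ 3 ∣ (W.baseChange (v.adicCompletion ℚ)).localTamagawaNumber (v.adicCompletionIntegers ℚ) := by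
  haveI := isElliptic_of_discOf_ne_zero 1 (-1) 0 (-2) (-1) (by decide)
  have hjE : (⟨((1 : ℤ) : ℚ), ((-1 : ℤ) : ℚ), ((0 : ℤ) : ℚ), ((-2 : ℤ) : ℚ), ((-1 : ℤ) : ℚ)⟩ : WeierstrassCurve ℚ).j = -3375 := by
    rw [j, Units.inv_mul_eq_iff_eq_mul, coe_Δ']
    norm_num [WeierstrassCurve.c₄, WeierstrassCurve.Δ, WeierstrassCurve.b₂, WeierstrassCurve.b₄,
      WeierstrassCurve.b₆, WeierstrassCurve.b₈]
  exact not_three_dvd_localTamagawaNumber_three_of_j_eq_twist W v hv 1 (-1) 0 (-2) (-1) (Dz := -343)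
    (by norm_num [WeierstrassCurve.Δ, WeierstrassCurve.b₂, WeierstrassCurve.b₄, WeierstrassCurve.b₆,
      WeierstrassCurve.b₈]) (by decide) (hj.trans hjE.symm) (by rw [hj]; norm_num) (by rw [hj]; norm_num)

/-- **`j = 16581375`** (`K = ℚ(√−7)`; base curve Cremona `49a2 = [1, -1, 0, -37, -78]`, `Δ = 343`, good at `3`): `3 ∤ c_3`.
[cite: SilvermanATAEC1994, IV.9.4 Step 6 and Table 4.1] [cite: Cremona1997, Table 1 (curve 49a2)] -/
theorem not_three_dvd_localTamagawaNumber_three_of_j_eq_16581375 (W : WeierstrassCurve ℚ) [W.IsElliptic]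
    (hj : W.j = 16581375) (v : HeightOneSpectrum (𝓞 ℚ)) (hv : natGenerator v = 3) :
    ¬ 3 ∣ (W.baseChange (v.adicCompletion ℚ)).localTamagawaNumber (v.adicCompletionIntegers ℚ) := by
  haveI := isElliptic_of_discOf_ne_zero 1 (-1) 0 (-37) (-78) (by decide)
  have hjE : (⟨((1 : ℤ) : ℚ), ((-1 : ℤ) : ℚ), ((0 : ℤ) : ℚ), ((-37 : ℤ) : ℚ), ((-78 : ℤ) : ℚ)⟩ : WeierstrassCurve ℚ).j = 16581375 := by
    rw [j, Units.inv_mul_eq_iff_eq_mul, coe_Δ']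
    norm_num [WeierstrassCurve.c₄, WeierstrassCurve.Δ, WeierstrassCurve.b₂, WeierstrassCurve.b₄,
      WeierstrassCurve.b₆, WeierstrassCurve.b₈]
  exact not_three_dvd_localTamagawaNumber_three_of_j_eq_twist W v hv 1 (-1) 0 (-37) (-78) (Dz := 343)
    (by norm_num [WeierstrassCurve.Δ, WeierstrassCurve.b₂, WeierstrassCurve.b₄, WeierstrassCurve.b₆,
      WeierstrassCurve.b₈]) (by decide) (hj.trans hjE.symm) (by rw [hj]; norm_num) (by rw [hj]; norm_num)

/-- **`j = 8000`** (`K = ℚ(√−2)`; base curve Cremona `256a1 = [0, 1, 0, -3, 1]`, `Δ = 512`, good at `3`): `3 ∤ c_3`.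
[cite: SilvermanATAEC1994, IV.9.4 Step 6 and Table 4.1] [cite: Cremona1997, Table 1 (curve 256a1)] -/
theorem not_three_dvd_localTamagawaNumber_three_of_j_eq_8000 (W : WeierstrassCurve ℚ) [W.IsElliptic]
    (hj : W.j = 8000) (v : HeightOneSpectrum (𝓞 ℚ)) (hv : natGenerator v = 3) :
    ¬ 3 ∣ (W.baseChange (v.adicCompletion ℚ)).localTamagawaNumber (v.adicCompletionIntegers ℚ) := by
  haveI := isElliptic_of_discOf_ne_zero 0 1 0 (-3) 1 (by decide)
  have hjE : (⟨((0 : ℤ) : ℚ), ((1 : ℤ) : ℚ), ((0 : ℤ) : ℚ), ((-3 : ℤ) : ℚ), ((1 : ℤ) : ℚ)⟩ : WeierstrassCurve ℚ).j = 8000 := by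
    rw [j, Units.inv_mul_eq_iff_eq_mul, coe_Δ']
    norm_num [WeierstrassCurve.c₄, WeierstrassCurve.Δ, WeierstrassCurve.b₂, WeierstrassCurve.b₄,
      WeierstrassCurve.b₆, WeierstrassCurve.b₈]
  exact not_three_dvd_localTamagawaNumber_three_of_j_eq_twist W v hv 0 1 0 (-3) 1 (Dz := 512)
    (by norm_num [WeierstrassCurve.Δ, WeierstrassCurve.b₂, WeierstrassCurve.b₄, WeierstrassCurve.b₆,
      WeierstrassCurve.b₈]) (by decide) (hj.trans hjE.symm) (by rw [hj]; norm_num) (by rw [hj]; norm_num)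

/-- **`j = -32768`** (`K = ℚ(√−11)`; base curve Cremona `121b1 = [0, -1, 1, -7, 10]`, `Δ = -1331`, good at `3`): `3 ∤ c_3`.
[cite: SilvermanATAEC1994, IV.9.4 Step 6 and Table 4.1] [cite: Cremona1997, Table 1 (curve 121b1)] -/
theorem not_three_dvd_localTamagawaNumber_three_of_j_eq_neg32768 (W : WeierstrassCurve ℚ) [W.IsElliptic]
    (hj : W.j = -32768) (v : HeightOneSpectrum (𝓞 ℚ)) (hv : natGenerator v = 3) :
    ¬ 3 ∣ (W.baseChange (v.adicCompletion ℚ)).localTamagawaNumber (v.adicCompletionIntegers ℚ) := by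
  haveI := isElliptic_of_discOf_ne_zero 0 (-1) 1 (-7) 10 (by decide)
  have hjE : (⟨((0 : ℤ) : ℚ), ((-1 : ℤ) : ℚ), ((1 : ℤ) : ℚ), ((-7 : ℤ) : ℚ), ((10 : ℤ) : ℚ)⟩ : WeierstrassCurve ℚ).j = -32768 := by
    rw [j, Units.inv_mul_eq_iff_eq_mul, coe_Δ']
    norm_num [WeierstrassCurve.c₄, WeierstrassCurve.Δ, WeierstrassCurve.b₂, WeierstrassCurve.b₄,
      WeierstrassCurve.b₆, WeierstrassCurve.b₈]
  exact not_three_dvd_localTamagawaNumber_three_of_j_eq_twist W v hv 0 (-1) 1 (-7) 10 (Dz := -1331)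
    (by norm_num [WeierstrassCurve.Δ, WeierstrassCurve.b₂, WeierstrassCurve.b₄, WeierstrassCurve.b₆,
      WeierstrassCurve.b₈]) (by decide) (hj.trans hjE.symm) (by rw [hj]; norm_num) (by rw [hj]; norm_num)

/-- **`j = -884736`** (`K = ℚ(√−19)`; base curve Cremona `361a1 = [0, 0, 1, -38, 90]`, `Δ = -6859`, good at `3`): `3 ∤ c_3`.
[cite: SilvermanATAEC1994, IV.9.4 Step 6 and Table 4.1] [cite: Cremona1997, Table 1 (curve 361a1)] -/
theorem not_three_dvd_localTamagawaNumber_three_of_j_eq_neg884736 (W : WeierstrassCurve ℚ) [W.IsElliptic]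
    (hj : W.j = -884736) (v : HeightOneSpectrum (𝓞 ℚ)) (hv : natGenerator v = 3) :
    ¬ 3 ∣ (W.baseChange (v.adicCompletion ℚ)).localTamagawaNumber (v.adicCompletionIntegers ℚ) := by
  haveI := isElliptic_of_discOf_ne_zero 0 0 1 (-38) 90 (by decide)
  have hjE : (⟨((0 : ℤ) : ℚ), ((0 : ℤ) : ℚ), ((1 : ℤ) : ℚ), ((-38 : ℤ) : ℚ), ((90 : ℤ) : ℚ)⟩ : WeierstrassCurve ℚ).j = -884736 := by
    rw [j, Units.inv_mul_eq_iff_eq_mul, coe_Δ']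
    norm_num [WeierstrassCurve.c₄, WeierstrassCurve.Δ, WeierstrassCurve.b₂, WeierstrassCurve.b₄,
      WeierstrassCurve.b₆, WeierstrassCurve.b₈]
  exact not_three_dvd_localTamagawaNumber_three_of_j_eq_twist W v hv 0 0 1 (-38) 90 (Dz := -6859)
    (by norm_num [WeierstrassCurve.Δ, WeierstrassCurve.b₂, WeierstrassCurve.b₄, WeierstrassCurve.b₆,
      WeierstrassCurve.b₈]) (by decide) (hj.trans hjE.symm) (by rw [hj]; norm_num) (by rw [hj]; norm_num)

/-- **`j = -884736000`** (`K = ℚ(√−43)`; base curve Cremona `1849a1 = [0, 0, 1, -860, 9707]`, `Δ = -79507`, good at `3`): `3 ∤ c_3`.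
[cite: SilvermanATAEC1994, IV.9.4 Step 6 and Table 4.1] [cite: Cremona1997, Table 1 (curve 1849a1)] -/
theorem not_three_dvd_localTamagawaNumber_three_of_j_eq_neg884736000 (W : WeierstrassCurve ℚ) [W.IsElliptic]
    (hj : W.j = -884736000) (v : HeightOneSpectrum (𝓞 ℚ)) (hv : natGenerator v = 3) :
    ¬ 3 ∣ (W.baseChange (v.adicCompletion ℚ)).localTamagawaNumber (v.adicCompletionIntegers ℚ) := by
  haveI := isElliptic_of_discOf_ne_zero 0 0 1 (-860) 9707 (by decide)
  have hjE : (⟨((0 : ℤ) : ℚ), ((0 : ℤ) : ℚ), ((1 : ℤ) : ℚ), ((-860 : ℤ) : ℚ), ((9707 : ℤ) : ℚ)⟩ : WeierstrassCurve ℚ).j = -884736000 := by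
    rw [j, Units.inv_mul_eq_iff_eq_mul, coe_Δ']
    norm_num [WeierstrassCurve.c₄, WeierstrassCurve.Δ, WeierstrassCurve.b₂, WeierstrassCurve.b₄,
      WeierstrassCurve.b₆, WeierstrassCurve.b₈]
  exact not_three_dvd_localTamagawaNumber_three_of_j_eq_twist W v hv 0 0 1 (-860) 9707 (Dz := -79507)
    (by norm_num [WeierstrassCurve.Δ, WeierstrassCurve.b₂, WeierstrassCurve.b₄, WeierstrassCurve.b₆,
      WeierstrassCurve.b₈]) (by decide) (hj.trans hjE.symm) (by rw [hj]; norm_num) (by rw [hj]; norm_num)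

/-- **`j = -147197952000`** (`K = ℚ(√−67)`; base curve Cremona `4489a1 = [0, 0, 1, -7370, 243528]`, `Δ = -300763`, good at `3`): `3 ∤ c_3`.
[cite: SilvermanATAEC1994, IV.9.4 Step 6 and Table 4.1] [cite: Cremona1997, Table 1 (curve 4489a1)] -/
theorem not_three_dvd_localTamagawaNumber_three_of_j_eq_neg147197952000 (W : WeierstrassCurve ℚ) [W.IsElliptic]
    (hj : W.j = -147197952000) (v : HeightOneSpectrum (𝓞 ℚ)) (hv : natGenerator v = 3) :
    ¬ 3 ∣ (W.baseChange (v.adicCompletion ℚ)).localTamagawaNumber (v.adicCompletionIntegers ℚ) := by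
  haveI := isElliptic_of_discOf_ne_zero 0 0 1 (-7370) 243528 (by decide)
  have hjE : (⟨((0 : ℤ) : ℚ), ((0 : ℤ) : ℚ), ((1 : ℤ) : ℚ), ((-7370 : ℤ) : ℚ), ((243528 : ℤ) : ℚ)⟩ : WeierstrassCurve ℚ).j = -147197952000 := by
    rw [j, Units.inv_mul_eq_iff_eq_mul, coe_Δ']
    norm_num [WeierstrassCurve.c₄, WeierstrassCurve.Δ, WeierstrassCurve.b₂, WeierstrassCurve.b₄,
      WeierstrassCurve.b₆, WeierstrassCurve.b₈]
  exact not_three_dvd_localTamagawaNumber_three_of_j_eq_twist W v hv 0 0 1 (-7370) 243528 (Dz := -300763)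
    (by norm_num [WeierstrassCurve.Δ, WeierstrassCurve.b₂, WeierstrassCurve.b₄, WeierstrassCurve.b₆,
      WeierstrassCurve.b₈]) (by decide) (hj.trans hjE.symm) (by rw [hj]; norm_num) (by rw [hj]; norm_num)

/-- **`j = -262537412640768000`** (`K = ℚ(√−163)`; base curve Cremona `26569a1 = [0, 0, 1, -2174420, 1234136692]`, `Δ = -4330747`, good at `3`): `3 ∤ c_3`.
[cite: SilvermanATAEC1994, IV.9.4 Step 6 and Table 4.1] [cite: Cremona1997, Table 1 (curve 26569a1)] -/
theorem not_three_dvd_localTamagawaNumber_three_of_j_eq_neg262537412640768000 (W : WeierstrassCurve ℚ) [W.IsElliptic]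
    (hj : W.j = -262537412640768000) (v : HeightOneSpectrum (𝓞 ℚ)) (hv : natGenerator v = 3) :
    ¬ 3 ∣ (W.baseChange (v.adicCompletion ℚ)).localTamagawaNumber (v.adicCompletionIntegers ℚ) := by
  haveI := isElliptic_of_discOf_ne_zero 0 0 1 (-2174420) 1234136692 (by decide)
  have hjE : (⟨((0 : ℤ) : ℚ), ((0 : ℤ) : ℚ), ((1 : ℤ) : ℚ), ((-2174420 : ℤ) : ℚ), ((1234136692 : ℤ) : ℚ)⟩ : WeierstrassCurve ℚ).j = -262537412640768000 := by
    rw [j, Units.inv_mul_eq_iff_eq_mul, coe_Δ']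
    norm_num [WeierstrassCurve.c₄, WeierstrassCurve.Δ, WeierstrassCurve.b₂, WeierstrassCurve.b₄,
      WeierstrassCurve.b₆, WeierstrassCurve.b₈]
  exact not_three_dvd_localTamagawaNumber_three_of_j_eq_twist W v hv 0 0 1 (-2174420) 1234136692 (Dz := -4330747)
    (by norm_num [WeierstrassCurve.Δ, WeierstrassCurve.b₂, WeierstrassCurve.b₄, WeierstrassCurve.b₆,
      WeierstrassCurve.b₈]) (by decide) (hj.trans hjE.symm) (by rw [hj]; norm_num) (by rw [hj]; norm_num)

/-! ### §2 Every CM curve with `3 ∤ d_K`: `3 ∤ c_3`, `3 ∤ ∏_ℓ c_ℓ`, and every prime factor of `∏_ℓ c_ℓ` is `2` -/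

/-- **`3 ∤ c_3` for every CM curve over `ℚ` whose CM field is not `ℚ(√−3)`** (`HasCM ⟺ j ∈
cmJInvariants`, tree theorem `hasCM_iff_j_mem_holds`; the three `j` with `d_K = −3` are excluded by
`¬ CMRamified W 3`; `j = 1728` by `not_three_dvd_localTamagawaNumber_three_of_j_eq_1728`, the nine
others by §1). [cite: SilvermanATAEC1994, IV.9.4, Table 4.1 and App. A §3] -/
theorem not_three_dvd_localTamagawaNumber_three_of_hasCM (W : WeierstrassCurve ℚ) [W.IsElliptic]
    (hCM : W.HasCM) (hnr : ¬ CMRamified W 3) (v : HeightOneSpectrum (𝓞 ℚ)) (hv : natGenerator v = 3) :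
    ¬ 3 ∣ (W.baseChange (v.adicCompletion ℚ)).localTamagawaNumber (v.adicCompletionIntegers ℚ) := by
  have hj : W.j ∈ cmJInvariants := (hasCM_iff_j_mem_holds W).mp hCM
  have hram : ∀ {j₀ : ℚ}, W.j = j₀ → cmFieldDiscrOfJ j₀ = -3 → False := fun h hd ↦
    hnr (by unfold CMRamified; rw [h, hd]; norm_num)
  simp only [cmJInvariants, Finset.mem_insert, Finset.mem_singleton] at hj
  rcases hj with h | h | h | h | h | h | h | h | h | h | h | h | h
  · exact (hram h (by norm_num [cmFieldDiscrOfJ])).elim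
  · exact not_three_dvd_localTamagawaNumber_three_of_j_eq_1728 W h v hv
  · exact not_three_dvd_localTamagawaNumber_three_of_j_eq_neg3375 W h v hv
  · exact not_three_dvd_localTamagawaNumber_three_of_j_eq_8000 W h v hv
  · exact not_three_dvd_localTamagawaNumber_three_of_j_eq_neg32768 W h v hv
  · exact (hram h (by norm_num [cmFieldDiscrOfJ])).elim
  · exact not_three_dvd_localTamagawaNumber_three_of_j_eq_287496 W h v hv
  · exact not_three_dvd_localTamagawaNumber_three_of_j_eq_neg884736 W h v hv
  · exact (hram h (by norm_num [cmFieldDiscrOfJ])).elim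
  · exact not_three_dvd_localTamagawaNumber_three_of_j_eq_16581375 W h v hv
  · exact not_three_dvd_localTamagawaNumber_three_of_j_eq_neg884736000 W h v hv
  · exact not_three_dvd_localTamagawaNumber_three_of_j_eq_neg147197952000 W h v hv
  · exact not_three_dvd_localTamagawaNumber_three_of_j_eq_neg262537412640768000 W h v hv

/-- **For EVERY globally minimal CM curve `E/ℚ` whose CM field is not `ℚ(√−3)` (`3 ∤ d_K`):
`3 ∤ ∏_ℓ c_ℓ(E)`** — no hypothesis on the reduction at `3` (the place `3` by
`not_three_dvd_localTamagawaNumber_three_of_hasCM`, every other place by the cube-discriminant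
argument `not_three_dvd_localTamagawaNumber_of_Δ_eq_cube`; a CM curve has no multiplicative place).
[cite: SilvermanATAEC1994, IV.9.4, Table 4.1, Cor. IV.9.2, IV.11.1 and App. A §3] -/
theorem not_three_dvd_tamagawaProduct_of_hasCM_of_not_cmRamified_three (W : WeierstrassCurve ℚ)
    [W.IsElliptic] [W.IsGloballyMinimal] (hCM : W.HasCM) (hnr : ¬ CMRamified W 3) :
    ¬ 3 ∣ W.tamagawaProduct := by
  obtain ⟨t, ht, hj⟩ := exists_j_eq_cube_of_hasCM_of_not_cmRamified_three W hCM hnr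
  obtain ⟨s, hs⟩ := exists_Δ_eq_cube_of_j_eq_cube W ht hj
  intro hdvd
  unfold WeierstrassCurve.tamagawaProduct at hdvd
  have hex : ∃ v : HeightOneSpectrum (𝓞 ℚ),
      3 ∣ (W.baseChange (v.adicCompletion ℚ)).localTamagawaNumber (v.adicCompletionIntegers ℚ) := by
    by_cases hfin : (Function.mulSupport fun v : HeightOneSpectrum (𝓞 ℚ) ↦
        (W.baseChange (v.adicCompletion ℚ)).localTamagawaNumber (v.adicCompletionIntegers ℚ)).Finite
    · rw [finprod_eq_prod _ hfin] at hdvd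
      obtain ⟨v, -, hv⟩ := (Nat.Prime.prime Nat.prime_three).exists_mem_finset_dvd hdvd
      exact ⟨v, hv⟩
    · rw [finprod_of_infinite_mulSupport hfin] at hdvd
      exact absurd (Nat.le_of_dvd one_pos hdvd) (by norm_num)
  obtain ⟨v, hv⟩ := hex
  by_cases h3 : natGenerator v = 3
  · exact not_three_dvd_localTamagawaNumber_three_of_hasCM W hCM hnr v h3 hv
  · refine not_three_dvd_localTamagawaNumber_of_Δ_eq_cube W hs v ?_ (fun h ↦ absurd h h3) hv
    intro hm
    haveI := Fact.mk (primesEquiv v).2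
    exact W.not_hasMultiplicativeReductionAtPrime_of_hasCM hCM (primesEquiv v : ℕ)
      ((W.hasMultiplicativeReductionAtPrime_iff_hasMultiplicativeReductionAt_ringOfIntegers v).mpr hm)

/-- **The Tamagawa product of a CM curve over `ℚ` with `3 ∤ d_K` is a power of `2`: every prime
factor of `∏_ℓ c_ℓ` is `2`** (`p ≥ 5`: every `c_ℓ ≤ 4`, gen 9 `not_dvd_tamagawaProduct_of_hasCM`;
`p = 3`: this file). [cite: SilvermanATAEC1994, Cor. IV.9.2 (d), IV.9.4 and Table 4.1] -/
theorem eq_two_of_prime_dvd_tamagawaProduct_of_hasCM (W : WeierstrassCurve ℚ) [W.IsElliptic]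
    [W.IsGloballyMinimal] (hCM : W.HasCM) (hnr : ¬ CMRamified W 3) {p : ℕ} (hp : p.Prime)
    (hdvd : p ∣ W.tamagawaProduct) : p = 2 := by
  haveI := Fact.mk hp
  by_contra hp2
  by_cases hp3 : p = 3
  · subst hp3; exact not_three_dvd_tamagawaProduct_of_hasCM_of_not_cmRamified_three W hCM hnr hdvd
  · exact not_dvd_tamagawaProduct_of_hasCM W hCM p (hp.five_le_of_ne_two_of_ne_three hp2 hp3) hdvd

/-! ### §3 Consumers: the inert-BAD-at-`3` sub-family of X12, every CM field, no Tamagawa datum -/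

section Consumers

variable
  (hGZ : ∀ (N : ℕ) [NeZero N] (W : WeierstrassCurve ℚ) (K : Type) [Field K] [NumberField K],
    gross_zagier N W K)
  (hKo : ∀ (N : ℕ) [NeZero N] (W : WeierstrassCurve ℚ) (K : Type) [Field K] [NumberField K],
    kolyvagin N W K)
  (hMN : ∀ (N : ℕ) [NeZero N] (W : WeierstrassCurve ℚ) (K : Type) [Field K] [NumberField K],
    MatarNekovar2019.thm03_padicValNat_card_sha_le_of_irreducible N W K)
  (hGZK : rank_eq_analyticRank_of_analyticRank_le_one) (hmod : hasEntireLFunction_rat)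
  (hnf : exists_isNewformOf) (hFH : friedbergHoffstein_exists_heegnerField_split_twist_ne_zero)
  (hCM8 : bsdTriple_of_hasCM_of_L_one_ne_zero)

include hGZ hKo hMN hGZK hmod hnf hFH hCM8

/-- **X12 at `p = 3`, `3 ∣ N`, `K ≠ ℚ(√−3)` — EVERY CM field: the UPPER half of `BSD(E,3)` from
published facts modulo ONLY the Manin datum `3 ∤ c(D)`** (gen 12's
`missingUpperBoundAt_three_of_classX12_of_bad` with its Tamagawa datum now a theorem).
[cite: MatarNekovar2019, Thm. 0.3 and §0.11] [cite: SilvermanATAEC1994, IV.9.4 and Table 4.1]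
[cite: Miller2011LMS, Def. 1.1] -/
theorem missingUpperBoundAt_three_of_classX12_of_bad'
    (W : WeierstrassCurve ℚ) [W.IsElliptic] [W.IsGloballyMinimal] [NeZero (W.conductorNorm ℤ)]
    (hX : ClassX12 W 3) (hbad : ¬ Good W 3) (hnr : ¬ CMRamified W 3)
    (D : ModularParametrizationData W (W.conductorNorm ℤ)) (hc : ¬ (3 : ℤ) ∣ D.c) :
    MissingUpperBoundAt W 3 :=
  missingUpperBoundAt_three_of_classX12_of_bad hGZ hKo hMN hGZK hmod hnf hFH hCM8 W hX hbad hnr D hc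
    (not_three_dvd_tamagawaProduct_of_hasCM_of_not_cmRamified_three W hX.1 hnr)

/-- **X12 at `p = 3`, `3 ∣ N`, `K ≠ ℚ(√−3)`: `BSD(E,3)` from the pair's OWN lower half**, modulo the
Manin datum only. [cite: MatarNekovar2019, Thm. 0.3 and §0.11] [cite: Miller2011LMS, §1 and Def. 1.1] -/
theorem bsdp_three_of_classX12_of_bad_of_lower'
    (W : WeierstrassCurve ℚ) [W.IsElliptic] [W.IsGloballyMinimal] [NeZero (W.conductorNorm ℤ)]
    (hX : ClassX12 W 3) (hbad : ¬ Good W 3) (hnr : ¬ CMRamified W 3)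
    (D : ModularParametrizationData W (W.conductorNorm ℤ)) (hc : ¬ (3 : ℤ) ∣ D.c)
    (hlowW : MissingLowerBoundAt W 3) : BSDp W 3 :=
  bsdp_three_of_classX12_of_bad_of_lower hGZ hKo hMN hGZK hmod hnf hFH hCM8 W hX hbad hnr D hc
    (not_three_dvd_tamagawaProduct_of_hasCM_of_not_cmRamified_three W hX.1 hnr) hlowW

/-- **Route T-KR at `p = 3` on X12 (`3 ∣ N`, `K ≠ ℚ(√−3)`), NO Tamagawa datum**: published facts +
Manin datum + a CERTIFIED `ord₃ #Ш(E)_an = 0` ⟹ `BSD(E,3)` (the per-pair lever of the 21 window /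
154 census inert-bad-at-`3` cells, one table column fewer). [cite: MatarNekovar2019, Thm. 0.3 and §0.11]
[cite: Miller2011LMS, §1 and Def. 1.1] -/
theorem bsdp_three_of_classX12_of_bad_of_shaAn_unit'
    (W : WeierstrassCurve ℚ) [W.IsElliptic] [W.IsGloballyMinimal] [NeZero (W.conductorNorm ℤ)]
    (hX : ClassX12 W 3) (hbad : ¬ Good W 3) (hnr : ¬ CMRamified W 3)
    (D : ModularParametrizationData W (W.conductorNorm ℤ)) (hc : ¬ (3 : ℤ) ∣ D.c)
    {q : ℚ} (hq : shaAn W = (q : ℂ)) (hv : padicValRat 3 q = 0) : BSDp W 3 :=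
  bsdp_three_of_classX12_of_bad_of_shaAn_unit hGZ hKo hMN hGZK hmod hnf hFH hCM8 W hX hbad hnr D hc
    (not_three_dvd_tamagawaProduct_of_hasCM_of_not_cmRamified_three W hX.1 hnr) hq hv

/-- **X12 at ANY odd prime `p ∤ d_K` of BAD reduction — the upper half of `BSD(E,p)` modulo ONLY the
Manin datum `p ∤ c(D)`**, uniformly in `p` (gen 9/12's `missingUpperBoundAt_of_classX12_of_bad_odd`
with the Tamagawa binder discharged: `p ≥ 5` by `not_dvd_tamagawaProduct_of_hasCM`, `p = 3` here).
[cite: MatarNekovar2019, Thm. 0.3 and §0.11] [cite: SilvermanATAEC1994, Cor. IV.9.2 (d), IV.9.4 and Table 4.1]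
[cite: Miller2011LMS, Def. 1.1] -/
theorem missingUpperBoundAt_of_classX12_of_bad_odd'
    (W : WeierstrassCurve ℚ) [W.IsElliptic] [W.IsGloballyMinimal] (p : ℕ) [Fact p.Prime]
    [NeZero (W.conductorNorm ℤ)]
    (hX : ClassX12 W p) (hp2 : p ≠ 2) (hbad : ¬ Good W p) (hnr : ¬ CMRamified W p)
    (D : ModularParametrizationData W (W.conductorNorm ℤ)) (hc : ¬ (p : ℤ) ∣ D.c) :
    MissingUpperBoundAt W p := by
  refine missingUpperBoundAt_of_classX12_of_bad_odd hGZ hKo hMN hGZK hmod hnf hFH hCM8 W p hX hp2 hbad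
    hnr D hc ?_
  by_cases hp3 : p = 3
  · subst hp3; exact not_three_dvd_tamagawaProduct_of_hasCM_of_not_cmRamified_three W hX.1 hnr
  · exact not_dvd_tamagawaProduct_of_hasCM W hX.1 p
      ((Fact.out : p.Prime).five_le_of_ne_two_of_ne_three hp2 hp3)

end Consumers

end Summit.BirchSwinnertonDyer.Rank1Residual.X12

end
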